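import Literature.Probability.Percolation.ArmSeparationUntwistSchemeFour
import Literature.Probability.Percolation.ArmSeparationInSchemeFour
import Literature.Probability.Percolation.ArmSeparationOutSchemeFour
import Literature.Probability.Percolation.ArmSeparationSmallRatioFour
import Literature.Probability.Percolation.ArmSeparationInLandingFour
import Literature.Probability.Percolation.OneArmQuasiMultNearCritical
import Literature.Probability.Percolation.CharLengthWRSW
import Literature.Probability.Percolation.TriThetaHalf
import Literature.Probability.Percolation.FiveArmLowerBound
import HarnessLib

/-!
# The near-critical arm-separation theorem for four alternating arms

Topic `Literature/Probability/Percolation`; family `crit-perc` / near-critical percolation on `𝕋`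
(P. Nolin, *Near-critical percolation in two dimensions*, EJP 13 (2008), Thm. 11 for `j = 4`,
`σ = BWBW` [arXiv 0711.4948: Thm. 10], §4.2–4.4). The assembly of the scheme: uniformly in
`p ∈ [1/2, 1/2 + δ)` and in `n₀ ≤ n`, `2n ≤ N ≤ L(p, ε)`,
`P_p(four alternating arms in the annulus (n, N)) ≤ c⁻¹ · P_p(sepFourArm n N)`,
where `sepFourArm n N` asks for the four arms to be well separated, with fences, on prescribed
landing areas (`altSeparation_display`).

* `altSeparation_core` — at a general `p`, from Russo–Seymour–Welsh inputs at `p` and `1 - p` for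
  boxes of height `≤ Ncap` (`N ≤ Ncap + 1`): the outer scheme
  (`exists_real_altFourArm_le_mul_extFourArmQ_at`), the inner scheme
  (`exists_real_extFourArmQ_le_mul_sepFourArmG_at`), the untwisting of the half-turned landing
  (`real_sepFourArmG_three_mul_le_sepFourArmQ_at`), two inward extensions
  (`real_sepFourArmG_mul_le_inward_at`), the half-step conversion to the sides `0, 1, 3, 4`
  (`real_sepFourArmQ_mul_le_sepFourArm_at`) at the scales `(24 n, ⌊N/4⌋) → (n, N)`, and the bounded
  ratios `N ≤ 256 n` directly (`pow_le_real_sepFourArm_smallRatio_at`);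
* `nearCritical_rsw_input` — the RSW inputs below Werner's length `L(p, ε)`, at `p` and `1 - p`
  (`exists_pow_le_triLRCrossingProb_below`, `charLengthW_le_charLength_of_gt`, `tri_rsw_half`);
* `altSeparation_display` — the display `(hsepA)` of `KestenScalingThetaFromTwoAltDisplays`.

Everything here is proved; no named facts are introduced.

## References

* P. Nolin, Near-critical percolation in two dimensions, *Electron. J. Probab.* 13 (2008), Thm. 11,
  §4.2–4.4 (arXiv 0711.4948: Thm. 10, Def. 6–8, Prop. 11–13, Lemma 12) [Nolin2008].
* H. Kesten, Scaling relations for 2D-percolation, *Comm. Math. Phys.* 109 (1987), Lemma 6 [Kesten1987].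
-/

noncomputable section

open MeasureTheory Set unitInterval

namespace Literature.Probability.Percolation

open LatticeModels

/-- **The arm-separation theorem for four alternating arms at a general `p`** (Nolin 2008, Thm. 11
for `σ = BWBW`, proof of §4.4): given the frame constant `cF` and the RSW constant `c` (aspect ratio
`1024`), there are aspect ratios `A, A'` such that for all RSW constants `cL, cL'` at those ratios
there are `κ > 0`, `n₀` with: at every `p`, if the four inputs hold at `p` and `1 - p` for heights
`≤ Ncap`, then `κ · P_p(altFourArm n N) ≤ P_p(sepFourArm n N)` for `n₀ ≤ n`, `2n ≤ N ≤ Ncap + 1`. [cite: Nolin2008, Thm. 11, §4.4 (arXiv 0711.4948: Thm. 10 and its proof)] -/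
theorem altSeparation_core {cF c : ℝ} (hcF : 0 < cF) (hcF1 : cF ≤ 1) (hc : 0 < c) (hc1 : c ≤ 1) :
    ∃ A A' : ℕ, 1 ≤ A ∧ 1 ≤ A' ∧ ∀ cL cL' : ℝ, 0 < cL → cL ≤ 1 → 0 < cL' → cL' ≤ 1 →
      ∃ κ : ℝ, 0 < κ ∧ ∃ n₀ : ℕ, ∀ (p : unitInterval) (Ncap : ℕ),
      (∀ q : unitInterval, (q = p ∨ q = unitInterval.symm p) →
        ∀ (z : Site 2) (k : ℕ), 1 ≤ k → k ≤ Ncap → cF ≤ (triSitePercolation q).real (triFrameAt z k)) →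
      (∀ q : unitInterval, (q = p ∨ q = unitInterval.symm p) →
        ∀ k : ℕ, 1 ≤ ⌊((1024 : ℕ) : ℝ) * k⌋₊ → k ≤ Ncap → c ≤ triLRCrossingProb q ⌊((1024 : ℕ) : ℝ) * k⌋₊ k) →
      (∀ q : unitInterval, (q = p ∨ q = unitInterval.symm p) →
        ∀ k : ℕ, 1 ≤ ⌊((A : ℕ) : ℝ) * k⌋₊ → k ≤ Ncap → cL ≤ triLRCrossingProb q ⌊((A : ℕ) : ℝ) * k⌋₊ k) →
      (∀ q : unitInterval, (q = p ∨ q = unitInterval.symm p) →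
        ∀ k : ℕ, 1 ≤ ⌊((A' : ℕ) : ℝ) * k⌋₊ → k ≤ Ncap → cL' ≤ triLRCrossingProb q ⌊((A' : ℕ) : ℝ) * k⌋₊ k) →
      ∀ n N : ℕ, n₀ ≤ n → 2 * n ≤ N → N ≤ Ncap + 1 →
        κ * altFourArmProbAt p n N ≤ (triSitePercolation p).real (sepFourArm n N) := by
  obtain ⟨K, hK⟩ := exists_real_altFourArm_le_mul_extFourArmQ_at hcF hcF1 hc hc1
  obtain ⟨K', hK'⟩ := exists_real_extFourArmQ_le_mul_sepFourArmG_at hcF hcF1 hc hc1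
  refine ⟨256 * 32 ^ K, 256 * 32 ^ K', Nat.succ_le_of_lt (by positivity), Nat.succ_le_of_lt (by positivity),
    fun cL cL' hcL hcL1 hcL' hcL'1 => ?_⟩
  obtain ⟨C, hC, n₀, hout⟩ := hK cL hcL hcL1
  obtain ⟨C', hC', n₀', hin⟩ := hK' cL' hcL' hcL'1
  -- the constants
  set HS : ℝ := (c ^ 93 * c ^ 95) ^ 2 * (c ^ 97 * c ^ 95) ^ 2 with hHS
  set U : ℝ := ((c ^ 101) ^ 2) ^ 2 with hU
  set Iw : ℝ := (c ^ 93) ^ 4 with hIw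
  set Sm : ℝ := (c ^ 100) ^ 4 with hSm
  set D : ℝ := min (Iw * Iw * HS) (U * HS) with hD
  have hHS0 : 0 < HS := by positivity
  have hU0 : 0 < U := by positivity
  have hI0 : 0 < Iw := by positivity
  have hS0 : 0 < Sm := by positivity
  have hD0 : 0 < D := lt_min (by positivity) (by positivity)
  refine ⟨min Sm (D / (2 * C * C')), lt_min hS0 (by positivity), max (max n₀ n₀') 1100,
    fun p Ncap hF h1024 hA hA' n N hn hnN hcap => ?_⟩
  have hx1 := le_max_left n₀ n₀'; have hx2 := le_max_right n₀ n₀'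
  have hx3 := le_max_left (max n₀ n₀') 1100; have hx4 := le_max_right (max n₀ n₀') 1100
  have hn0 : n₀ ≤ n := by omega
  have hn0' : n₀' ≤ n := by omega
  have hn11 : 1100 ≤ n := by omega
  have halt0 : 0 ≤ altFourArmProbAt p n N := altFourArmProbAt_nonneg _ _ _
  have halt1 : altFourArmProbAt p n N ≤ 1 := altFourArmProbAt_le_one _ _ _
  set μ := triSitePercolation p with hμ
  have h0 : ∀ s, 0 ≤ μ.real s := fun s => measureReal_nonneg
  rcases le_or_gt N (256 * n) with hsmall | hlarge
  · -- bounded ratio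
    have h := pow_le_real_sepFourArm_smallRatio_at p h1024 le_rfl hc.le hc1 hn11 hnN hsmall (by omega)
    calc min Sm (D / (2 * C * C')) * altFourArmProbAt p n N ≤ Sm * 1 :=
          mul_le_mul (min_le_left _ _) halt1 halt0 hS0.le
      _ ≤ μ.real (sepFourArm n N) := by rw [mul_one]; exact h
  · -- the scheme at the scales `(24 n, ⌊N/4⌋)`
    set m₀ : ℕ := 24 * n with hm₀
    set Nq : ℕ := N / 4 with hNq
    have hNq1 : 4 * Nq ≤ N := by omega
    have hNq2 : N ≤ 32 * Nq := by omega
    have hmNq : 2 * m₀ ≤ Nq := by omega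
    have hNqcap : Nq ≤ Ncap := by omega
    have hm₀cap : m₀ ≤ Ncap := by omega
    have hN2cap : N ≤ 2 * Ncap := by omega
    -- monotonicity of the alternating four-arm event
    have hmono : altFourArmProbAt p n N ≤ altFourArmProbAt p m₀ Nq :=
      (altFourArmProbAt_anti p n (show n ≤ Nq by omega) (show Nq ≤ N by omega)).trans
        (altFourArmProbAt_mono_left p (show n ≤ m₀ by omega) (by omega))
    -- the two schemes
    have h1 : altFourArmProbAt p m₀ Nq ≤ C * μ.real (extFourArmQ m₀ Nq) :=
      hout p Ncap hF h1024 hA m₀ Nq (by omega) hmNq hNqcap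
    have h2 : μ.real (extFourArmQ m₀ Nq) ≤ C' * (μ.real (sepFourArmG m₀ Nq 0) + μ.real (sepFourArmG m₀ Nq 3)) :=
      hin p Ncap hF h1024 hA' m₀ Nq (by omega) hmNq hNqcap
    -- the branch `q = 0`: two inward extensions and the half-step
    have hG0a : μ.real (sepFourArmG m₀ Nq 0) * Iw ≤ μ.real (sepFourArmG (8 * n) Nq 0) :=
      real_sepFourArmG_mul_le_inward_at p h1024 (by norm_num) hc.le (by norm_num) (by omega) (by omega) (by omega) hmNq hm₀cap
    have hG0b : μ.real (sepFourArmG (8 * n) Nq 0) * Iw ≤ μ.real (sepFourArmG (3 * n) Nq 0) :=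
      real_sepFourArmG_mul_le_inward_at p h1024 (by norm_num) hc.le (by norm_num) (by omega) (by omega) (by omega) (by omega) (by omega)
    have hG0c : μ.real (sepFourArmQ (3 * n) Nq) * HS ≤ μ.real (sepFourArm n N) :=
      real_sepFourArmQ_mul_le_sepFourArm_at p h1024 (by norm_num) hc.le hn11 (by omega) (by omega) (by omega) (by omega) hNq1 hNq2 hN2cap
    rw [sepFourArmG_zero (3 * n) Nq] at hG0b
    have hG0 : μ.real (sepFourArmG m₀ Nq 0) * (Iw * Iw * HS) ≤ μ.real (sepFourArm n N) := by
      calc μ.real (sepFourArmG m₀ Nq 0) * (Iw * Iw * HS) = μ.real (sepFourArmG m₀ Nq 0) * Iw * Iw * HS := by ring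
        _ ≤ μ.real (sepFourArmG (8 * n) Nq 0) * Iw * HS := by
            exact mul_le_mul_of_nonneg_right (mul_le_mul_of_nonneg_right hG0a hI0.le) hHS0.le
        _ ≤ μ.real (sepFourArmQ (3 * n) Nq) * HS := mul_le_mul_of_nonneg_right hG0b hHS0.le
        _ ≤ _ := hG0c
    -- the branch `q = 3`: the untwisting and the half-step
    have hG3a : μ.real (sepFourArmG m₀ Nq 3) * U ≤ μ.real (sepFourArmQ (8 * (m₀ / 64)) Nq) :=
      real_sepFourArmG_three_mul_le_sepFourArmQ_at p h1024 (by norm_num) hc.le (by omega) hmNq hm₀cap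
    have hG3b : μ.real (sepFourArmQ (8 * (m₀ / 64)) Nq) * HS ≤ μ.real (sepFourArm n N) :=
      real_sepFourArmQ_mul_le_sepFourArm_at p h1024 (by norm_num) hc.le hn11 (by omega) (by omega) (by omega) (by omega) hNq1 hNq2 hN2cap
    have hG3 : μ.real (sepFourArmG m₀ Nq 3) * (U * HS) ≤ μ.real (sepFourArm n N) := by
      calc μ.real (sepFourArmG m₀ Nq 3) * (U * HS) = μ.real (sepFourArmG m₀ Nq 3) * U * HS := by ring
        _ ≤ μ.real (sepFourArmQ (8 * (m₀ / 64)) Nq) * HS := mul_le_mul_of_nonneg_right hG3a hHS0.le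
        _ ≤ _ := hG3b
    -- assembly
    have hsum : (μ.real (sepFourArmG m₀ Nq 0) + μ.real (sepFourArmG m₀ Nq 3)) * D ≤ 2 * μ.real (sepFourArm n N) := by
      have a : μ.real (sepFourArmG m₀ Nq 0) * D ≤ μ.real (sepFourArm n N) :=
        (mul_le_mul_of_nonneg_left (min_le_left (Iw * Iw * HS) (U * HS)) (h0 _)).trans hG0
      have b : μ.real (sepFourArmG m₀ Nq 3) * D ≤ μ.real (sepFourArm n N) :=
        (mul_le_mul_of_nonneg_left (min_le_right (Iw * Iw * HS) (U * HS)) (h0 _)).trans hG3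
      rw [add_mul]; linarith
    have halt : altFourArmProbAt p n N ≤ C * C' * (μ.real (sepFourArmG m₀ Nq 0) + μ.real (sepFourArmG m₀ Nq 3)) := by
      calc altFourArmProbAt p n N ≤ C * μ.real (extFourArmQ m₀ Nq) := hmono.trans h1
        _ ≤ C * (C' * (μ.real (sepFourArmG m₀ Nq 0) + μ.real (sepFourArmG m₀ Nq 3))) := mul_le_mul_of_nonneg_left h2 hC.le
        _ = _ := by ring
    have hCC : 0 < 2 * C * C' := by positivity
    calc min Sm (D / (2 * C * C')) * altFourArmProbAt p n N ≤ D / (2 * C * C') * altFourArmProbAt p n N :=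
          mul_le_mul_of_nonneg_right (min_le_right _ _) halt0
      _ ≤ D / (2 * C * C') * (C * C' * (μ.real (sepFourArmG m₀ Nq 0) + μ.real (sepFourArmG m₀ Nq 3))) :=
          mul_le_mul_of_nonneg_left halt (by positivity)
      _ = (μ.real (sepFourArmG m₀ Nq 0) + μ.real (sepFourArmG m₀ Nq 3)) * D / 2 := by
          field_simp
      _ ≤ μ.real (sepFourArm n N) := by linarith

/-- **The RSW inputs below Werner's length, at `t` and at `1 - t`** (aspect ratio `ρ`): a constant
`b ∈ (0, 1]` with `b ≤ P_q(long-way crossing of [0, ρ k] × [0, k])` for `q ∈ {t, 1 - t}`,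
`1/2 ≤ t < 3/4`, and `k ≤ Ncap` whenever `Ncap < L(t, ε)` for `t > 1/2` (near-critical RSW below
Nolin's length `exists_pow_le_triLRCrossingProb_below`, Werner's length below Nolin's
`charLengthW_le_charLength_of_gt`, and RSW at `1/2`). [cite: Nolin2008, §3.1 (3.5)–(3.6), §3.3 Prop. 5 (arXiv 0711.4948: §3)] -/
theorem nearCritical_rsw_input {ε ε' η : ℝ}
    (hLen : ∀ p : unitInterval, 1 / 2 < (p : ℝ) → (p : ℝ) < 3 / 4 → charLengthW ε p ≤ charLength ε' p)
    (hRSW : ∀ p q : unitInterval, min p (σ p) ≤ q → ∀ h : ℕ, 1 ≤ h → h < charLength ε' p →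
      ∀ j w : ℕ, 1 ≤ j → w ≤ (j + 1) * h → η ^ j ≤ triLRCrossingProb q w h)
    (hη0 : 0 < η) (hη1 : η ≤ 1) (ρ : ℕ) (hρ : 1 ≤ ρ) :
    ∃ b : ℝ, 0 < b ∧ b ≤ 1 ∧ ∀ t : unitInterval, 1 / 2 ≤ (t : ℝ) → (t : ℝ) < 3 / 4 →
      ∀ Ncap : ℕ, (1 / 2 < (t : ℝ) → Ncap < charLengthW ε t) →
        ∀ q : unitInterval, (q = t ∨ q = unitInterval.symm t) →
          ∀ k : ℕ, 1 ≤ ⌊((ρ : ℕ) : ℝ) * k⌋₊ → k ≤ Ncap → b ≤ triLRCrossingProb q ⌊((ρ : ℕ) : ℝ) * k⌋₊ k := by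
  obtain ⟨c₀, hc₀, hhalf⟩ := tri_rsw_half_holds ρ (by exact_mod_cast hρ)
  refine ⟨min (η ^ ρ) c₀, lt_min (pow_pos hη0 _) hc₀, (min_le_left _ _).trans (pow_le_one₀ hη0.le hη1),
    fun t ht1 ht2 Ncap hcapL q hq k hk hkcap => ?_⟩
  have hfl : ⌊((ρ : ℕ) : ℝ) * k⌋₊ = ρ * k := nat_floor_natCast_mul ρ k
  rcases eq_or_lt_of_le ht1 with heq | hgt
  · -- `t = 1/2`
    have ht : t = half := Subtype.ext (by rw [coe_half]; exact heq.symm)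
    have hq' : q = half := by
      rcases hq with rfl | rfl
      · exact ht
      · rw [ht, symm_half]
    rw [hq']
    exact (min_le_right _ _).trans (hhalf k hk).1
  · -- `t > 1/2`: below Nolin's length
    have hk1 : 1 ≤ k := by
      rw [hfl] at hk
      rcases Nat.eq_zero_or_pos k with h | h
      · rw [h, Nat.mul_zero] at hk; omega
      · exact h
    have hkL : k < charLength ε' t := lt_of_lt_of_le (lt_of_le_of_lt hkcap (hcapL hgt)) (hLen t hgt ht2)
    have hqmin : min t (σ t) ≤ q := by
      rcases hq with rfl | rfl
      · exact min_le_left _ _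
      · exact min_le_right _ _
    have := hRSW t q hqmin k hk1 hkL ρ (ρ * k) hρ (by nlinarith)
    rw [hfl]
    exact (min_le_left _ _).trans this

/-- **Near-critical arm separation for four alternating arms — the display `(hsepA)`** (Nolin 2008,
Thm. 11 for `σ = BWBW` combined with Prop. 12 (i); Kesten 1987, Lemma 6): for `ε ∈ (0, 1)` there
are `n₀`, `δ = 1/4`, `c > 0` with `c · P_t(altFourArm n N) ≤ P_t(sepFourArm n N)` for all
`t ∈ [1/2, 3/4)`, `n₀ ≤ n`, `2n ≤ N`, `N ≤ L(t, ε)` when `t > 1/2`. [cite: Nolin2008, Thm. 11 and Prop. 12 (arXiv 0711.4948: Thm. 10, Prop. 11); Kesten1987, Lemma 6] -/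
theorem altSeparation_display :
    ∃ ε₁ > (0 : ℝ), ∀ ⦃ε : ℝ⦄, 0 < ε → ε < ε₁ →
      ∃ n₀ : ℕ, ∃ δ > (0 : ℝ), ∃ c > (0 : ℝ),
        ∀ t : unitInterval, 1 / 2 ≤ (t : ℝ) → (t : ℝ) < 1 / 2 + δ →
          ∀ n N : ℕ, n₀ ≤ n → 2 * n ≤ N → (1 / 2 < (t : ℝ) → N ≤ charLengthW ε t) →
            c * altFourArmProbAt t n N ≤ (triSitePercolation t).real (sepFourArm n N) := by
  refine ⟨1, one_pos, fun ε hε _ => ?_⟩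
  obtain ⟨ε', hε', hε'2, hLen⟩ := charLengthW_le_charLength_of_gt hε
  obtain ⟨η, hη0, hη1, hRSW⟩ := exists_pow_le_triLRCrossingProb_below hε' hε'2
  -- the inputs at aspect ratios `4` and `1024`
  obtain ⟨b₄, hb₄, hb₄1, h₄⟩ := nearCritical_rsw_input hLen hRSW hη0 hη1 4 (by norm_num)
  obtain ⟨b, hb, hb1, h₁₀₂₄⟩ := nearCritical_rsw_input hLen hRSW hη0 hη1 1024 (by norm_num)
  have hcF : 0 < b₄ ^ 4 := by positivity
  have hcF1 : b₄ ^ 4 ≤ 1 := pow_le_one₀ hb₄.le hb₄1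
  obtain ⟨A, A', hA1, hA'1, hcore⟩ := altSeparation_core hcF hcF1 hb hb1
  obtain ⟨bA, hbA, hbA1, hAi⟩ := nearCritical_rsw_input hLen hRSW hη0 hη1 A hA1
  obtain ⟨bA', hbA', hbA'1, hA'i⟩ := nearCritical_rsw_input hLen hRSW hη0 hη1 A' hA'1
  obtain ⟨κ, hκ, n₀, hmain⟩ := hcore bA bA' hbA hbA1 hbA' hbA'1
  refine ⟨max n₀ 1, 1 / 4, by norm_num, κ, hκ, fun t ht1 ht2 n N hn hnN hNL => ?_⟩
  have ht34 : (t : ℝ) < 3 / 4 := by linarith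
  have hN1 : 1 ≤ N := by have := le_max_right n₀ 1; omega
  have hcapL : 1 / 2 < (t : ℝ) → N - 1 < charLengthW ε t := fun h => by have := hNL h; omega
  have hfl4 : ∀ k : ℕ, ⌊((4 : ℕ) : ℝ) * k⌋₊ = 4 * k := fun k => nat_floor_natCast_mul 4 k
  have hF : ∀ q : unitInterval, (q = t ∨ q = unitInterval.symm t) →
      ∀ (z : Site 2) (k : ℕ), 1 ≤ k → k ≤ N - 1 → b₄ ^ 4 ≤ (triSitePercolation q).real (triFrameAt z k) := by
    intro q hq z k hk hkc
    have h := h₄ t ht1 ht34 (N - 1) hcapL q hq k (by rw [hfl4]; omega) hkc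
    rw [hfl4] at h
    exact le_real_triFrameAt_of_rsw q hb₄.le z k h
  exact hmain t (N - 1) hF (h₁₀₂₄ t ht1 ht34 (N - 1) hcapL) (hAi t ht1 ht34 (N - 1) hcapL) (hA'i t ht1 ht34 (N - 1) hcapL)
    n N (le_trans (le_max_left _ _) hn) hnN (by omega)

end Literature.Probability.Percolation
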